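import Summits.RiemannHypothesis.RiemannHypothesis.Theses.IntegerScrew
import Summits.RiemannHypothesis.RiemannHypothesis.Theorems.WeilCombCombSubcritical
import Summits.RiemannHypothesis.RiemannHypothesis.Theorems.WeilCombCombHelsonBound
import Summits.RiemannHypothesis.RiemannHypothesis.Theorems.IntegerScrewScrewPolyFloorCombDominated
import Summits.RiemannHypothesis.RiemannHypothesis.Theorems.IntegerScrewScrewPolyFloorBump
import Summits.RiemannHypothesis.RiemannHypothesis.Theorems.IntegerScrewScrewPolyFloorShadow
import Summits.RiemannHypothesis.RiemannHypothesis.Theorems.IntegerScrewScrewPolyFloorEndgame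
import HarnessLib

/-!
# Route IntegerScrew — `FloorOfRH` (item stmt-RiemannHypothesis-15762): RH ⇒ the polynomial floor

THE FLOOR LAW UNDER RH, assembled along line `weil_comb_floor` of crux `ScrewPolyFloor`
(stmt-RiemannHypothesis-15757; composition `FloorOfRH_of` of
`Cruxes/ScrewPolyFloor/Lines/weil_comb_floor.lean`, here with the line's objects inlined):

* one admissible bump `φ` (`stub_bumpWitness`, seat 1);
* WeilComb's PROVED analytic reduction of the Weil form of the log-integer comb
  `g = Σ_{m ≤ M} y_m ε⁻¹ φ((· − log m)/ε)` (`WeilCombSubcritical.analyticReduction`): for `8εM ≤ 1`,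
  `Re Q(g) ≥ ε⁻¹‖φ‖₂²[(log(1/ε) − C)‖y‖² − Helson_Λ(y) − ε·shadow(y)]`;
* the Helson bound `Helson_Λ(y) ≤ (log M + 1)‖y‖²` (`combHelsonBound_proof`, PROVED) and the shadow
  budget `shadow(y) ≤ 12M²‖y‖²` (`stub_shadowBudget`, seat 1);
* under RH the domination `Re Q(g) ≤ ‖φ'‖₁'² ε⁻² · (y·S_M·y)` (`stub_combDominated`, seat 0: explicit
  formula + comb transform + one integration by parts + the Gram expansion of the screw form);
* the parameter choice `ε = M^{−K}` (`stub_endgameComb`, seat 1).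

With `y = (−Σ_{m≥2} x_m, x_2, …, x_M)` (so `Σ y = 0` and the screw form of `y` on `{2..M}` is that
of `x`), this gives `c M^{−A} Σ_{m≥2} x_m² ≤ c M^{−A}‖y‖² ≤ x·S_M·x`.  Axioms: standard.
-/

-- `Summit.RiemannHypothesis.RiemannHypothesis.…` duplicates `RiemannHypothesis` BY DESIGN (D-0017).
set_option linter.dupNamespace false

noncomputable section

namespace Summit.RiemannHypothesis.RiemannHypothesis.Theorems

open Literature.NumberTheory.LFunctions
open scoped BigOperators ComplexConjugate
open Finset

/-- **`FloorOfRH`** (route IntegerScrew, item stmt-RiemannHypothesis-15762): the Riemann hypothesis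
implies a POLYNOMIAL floor for the screw-kernel Gram matrices on the logarithms of the integers —
there are `A` and `c > 0` with `c M^{−A} Σ_{2≤m≤M} x_m² ≤ Σ_{2≤m,m'≤M} G(log m, log m') x_m x_m'`
for all `M` and all real `x`. -/
theorem floorOfRH_proof :
    Summit.RiemannHypothesis.RiemannHypothesis.Theses.IntegerScrew.FloorOfRH := by
  intro hRH
  obtain ⟨φ, hφ, hsupp, hN, hB⟩ := IntegerScrewScrewPolyFloor.stub_bumpWitness
  obtain ⟨C, hC⟩ :=
    Summit.RiemannHypothesis.RiemannHypothesis.Theorems.WeilCombSubcritical.analyticReduction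
  obtain ⟨K, A, c, hc, hK⟩ := IntegerScrewScrewPolyFloor.stub_endgameComb C (weilNorm2Sq φ)
    (weilL1 (deriv φ) ^ 2) hN (by positivity)
  refine ⟨A, c, hc, fun M x => ?_⟩
  rcases lt_or_ge M 2 with hM | hM
  · have hE : Finset.Icc 2 M = ∅ := Finset.Icc_eq_empty (by omega)
    simp [hE]
  classical
  obtain ⟨h8, hmain⟩ := hK M hM
  have hM1 : 1 ≤ M := by omega
  -- the parameter
  set ε : ℝ := ((M : ℝ) ^ K)⁻¹ with hεdef
  have hε : 0 < ε := by rw [hεdef]; positivity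
  -- the test vector with vanishing sum
  set y : ℕ → ℝ := fun m => if m = 1 then -∑ k ∈ Finset.Icc 2 M, x k else x m with hydef
  have hsplit : Finset.Icc 1 M = insert 1 (Finset.Icc 2 M) := by
    ext k
    simp only [Finset.mem_Icc, Finset.mem_insert]
    omega
  have h1notin : (1 : ℕ) ∉ Finset.Icc 2 M := by simp
  have hyx : ∀ k ∈ Finset.Icc 2 M, y k = x k := by
    intro k hk
    have hk1 : k ≠ 1 := by
      simp only [Finset.mem_Icc] at hk
      omega
    simp [hydef, hk1]
  have hy1 : y 1 = -∑ k ∈ Finset.Icc 2 M, x k := by simp [hydef]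
  have hsum0 : ∑ m ∈ Finset.Icc 1 M, y m = 0 := by
    rw [hsplit, Finset.sum_insert h1notin, Finset.sum_congr rfl hyx, hy1]
    ring
  -- the four analytic inputs
  have h8' : 8 * ε * M ≤ 1 := by rw [hεdef]; exact h8
  have hR := hC φ hφ hsupp ε hε M (fun m => ((y m : ℝ) : ℂ)) hM1 h8'
  have hD := IntegerScrewScrewPolyFloor.stub_combDominated hRH φ hφ M ε y hM1 hε hsum0
  have hHel0 := Summit.RiemannHypothesis.RiemannHypothesis.Theorems.combHelsonBound_proof
  unfold Summit.RiemannHypothesis.RiemannHypothesis.Theses.WeilComb.CombHelsonBound at hHel0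
  have hHel := hHel0 M (fun m => ((y m : ℝ) : ℂ)) hM1
  have hSh := IntegerScrewScrewPolyFloor.stub_shadowBudget M y hM1
  -- names for the atoms
  set N : ℝ := weilNorm2Sq φ with hNdef
  set B : ℝ := weilL1 (deriv φ) ^ 2 with hBdef
  set L : ℝ := ∑ m ∈ Finset.Icc 1 M, ‖((y m : ℝ) : ℂ)‖ ^ 2 with hLdef
  set H : ℝ := 2 * (∑ m ∈ Finset.Icc 1 M, ∑ n ∈ Finset.Icc 1 (M / m),
    ((ArithmeticFunction.vonMangoldt n : ℝ) : ℂ) / (Real.sqrt n : ℂ) * ((y (n * m) : ℝ) : ℂ) *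
      conj ((y m : ℝ) : ℂ)).re with hHdef
  set Sh : ℝ := 5 * (∑ m ∈ Finset.Icc 1 M, ‖((y m : ℝ) : ℂ)‖ / Real.sqrt m) *
      (∑ m ∈ Finset.Icc 1 M, ‖((y m : ℝ) : ℂ)‖ * Real.sqrt m) +
    2 * (∑ m ∈ Finset.Icc 1 M, ∑ m' ∈ (Finset.Icc 1 M).erase m,
      ‖((y m : ℝ) : ℂ)‖ * ‖((y m' : ℝ) : ℂ)‖ / |Real.log m - Real.log m'|) +
    2 * (∑ m ∈ Finset.Icc 1 M, ‖((y m : ℝ) : ℂ)‖) ^ 2 with hShdef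
  set Q : ℝ := (weilQuadratic (fun x : ℝ => ∑ m ∈ Finset.Icc 1 M,
    ((y m : ℝ) : ℂ) * ((ε : ℂ)⁻¹ * φ ((x - Real.log (m : ℝ)) / ε)))).re with hQdef
  set SF : ℝ := ∑ m ∈ Finset.Icc 2 M, ∑ m' ∈ Finset.Icc 2 M,
    zetaScrewKernel (Real.log m) (Real.log m') * (y m * y m') with hSFdef
  have hL0 : 0 ≤ L := Finset.sum_nonneg fun m _ => sq_nonneg _
  have hεN : 0 ≤ ε⁻¹ * N := mul_nonneg (inv_nonneg.2 hε.le) hN.le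
  -- the inputs in the named shape (definitional)
  have hR' : ε⁻¹ * N * ((Real.log (1 / ε) - C) * L - H - ε * Sh) ≤ Q := hR
  have hD' : Q ≤ B * ε⁻¹ ^ 2 * SF := hD
  have hHel' : H ≤ (Real.log M + 1) * L := hHel
  have hSh' : Sh ≤ 12 * (M : ℝ) ^ 2 * L := hSh
  -- monotonicity inside the bracket
  have hmono : ε⁻¹ * N *
      (L * (Real.log (1 / ε) - C - (Real.log M + 1) - ε * (12 * (M : ℝ) ^ 2))) ≤
      ε⁻¹ * N * ((Real.log (1 / ε) - C) * L - H - ε * Sh) := by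
    apply mul_le_mul_of_nonneg_left _ hεN
    have a2 : ε * Sh ≤ ε * (12 * (M : ℝ) ^ 2 * L) := mul_le_mul_of_nonneg_left hSh' hε.le
    have e1 : L * (Real.log (1 / ε) - C - (Real.log M + 1) - ε * (12 * (M : ℝ) ^ 2)) =
        (Real.log (1 / ε) - C) * L - (Real.log M + 1) * L - ε * (12 * (M : ℝ) ^ 2 * L) := by
      ring
    rw [e1]
    linarith
  have key : ε⁻¹ * N *
      (L * (Real.log (1 / ε) - C - (Real.log M + 1) - ε * (12 * (M : ℝ) ^ 2))) ≤
      B * ε⁻¹ ^ 2 * SF :=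
    le_trans (le_trans hmono hR') hD'
  -- the screw form and the squares in the `x` variables
  have hQx : SF = ∑ m ∈ Icc 2 M, ∑ m' ∈ Icc 2 M,
      zetaScrewKernel (Real.log m) (Real.log m') * (x m * x m') := by
    rw [hSFdef]
    exact Finset.sum_congr rfl fun m hm => Finset.sum_congr rfl fun m' hm' => by
      rw [hyx m hm, hyx m' hm']
  have hsqy : ∑ k ∈ Icc 2 M, x k ^ 2 = ∑ k ∈ Icc 2 M, y k ^ 2 :=
    Finset.sum_congr rfl fun k hk => by rw [hyx k hk]
  have hsq : ∑ m ∈ Icc 2 M, x m ^ 2 ≤ L := by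
    rw [hsqy, hLdef]
    have hsub : Icc 2 M ⊆ Icc 1 M := by
      intro k hk
      simp only [Finset.mem_Icc] at hk ⊢
      omega
    have e : ∀ m, ‖((y m : ℝ) : ℂ)‖ ^ 2 = y m ^ 2 := fun m => by
      rw [Complex.norm_real, Real.norm_eq_abs, sq_abs]
    simp_rw [e]
    exact Finset.sum_le_sum_of_subset_of_nonneg hsub fun m _ _ => sq_nonneg _
  have hcA : 0 ≤ c * (M : ℝ) ^ (-A) :=
    mul_nonneg hc.le (Real.rpow_nonneg (Nat.cast_nonneg M) _)
  have hBε : 0 < B * ε⁻¹ ^ 2 := by positivity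
  have hεne : ε ≠ 0 := hε.ne'
  have hBne : B ≠ 0 := by positivity
  set br : ℝ := Real.log (1 / ε) - C - (Real.log M + 1) - ε * (12 * (M : ℝ) ^ 2) with hbr
  have e3 : ε * N / B * br * L = (B * ε⁻¹ ^ 2)⁻¹ * (ε⁻¹ * N * (L * br)) := by
    field_simp
  have e4 : (B * ε⁻¹ ^ 2)⁻¹ * (B * ε⁻¹ ^ 2 * SF) = SF := by
    field_simp
  -- endgame: `c M^{-A} ≤ ε N/B · bracket`
  have hmain' : c * (M : ℝ) ^ (-A) ≤ ε * N / B * br := by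
    simpa only [hεdef, hNdef, hBdef, hbr] using hmain
  calc c * (M : ℝ) ^ (-A) * ∑ m ∈ Icc 2 M, x m ^ 2
      ≤ c * (M : ℝ) ^ (-A) * L := mul_le_mul_of_nonneg_left hsq hcA
    _ ≤ ε * N / B * br * L := mul_le_mul_of_nonneg_right hmain' hL0
    _ = (B * ε⁻¹ ^ 2)⁻¹ * (ε⁻¹ * N * (L * br)) := e3
    _ ≤ (B * ε⁻¹ ^ 2)⁻¹ * (B * ε⁻¹ ^ 2 * SF) :=
        mul_le_mul_of_nonneg_left key (inv_nonneg.2 hBε.le)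
    _ = SF := e4
    _ = ∑ m ∈ Icc 2 M, ∑ m' ∈ Icc 2 M,
          zetaScrewKernel (Real.log m) (Real.log m') * (x m * x m') := hQx

end Summit.RiemannHypothesis.RiemannHypothesis.Theorems

end
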